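import Summits.Ventures.PercRepro.SevenThreeLineClasses

/-!
# PercRepro — the `(7,3)` cell: THE LINE FIBRE BOUND (p3, gen 16)

For a line `λ` of the dual (`drk λ = 2`, `dcl λ = λ`) the LINE FIBRE — the `Z ⊆ λ ∩ W` with `drk Z = 2` — sums to
the line table's `deltaN |λ ∩ T| ℓ₀ cs / Lc` with `cs` the sizes of the series-class traces on `(λ ∩ W) ∖ L₀`
(`line_fibre_sum`: the pointwise transfer `bracket_line_eq` and the recursion `classSum_eq_sum`), and when the fibre is
nonempty its datum satisfies `|λ ∩ T| ≤ 2`, `|λ ∩ W| ≤ 5` (`line_datum_bounds`: the circuit `E ∖ λ` meets `T` and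
has two points of `W`), so the table (`deltaN_ge_of_datum`) gives **`line_fibre_bound`**:
`Σ_{fibre of λ} bracket ≥ lineBound ℓ₀ / Lc` — `≥ 0` for `ℓ₀ ≤ 2`, `≥ −53/4830` at `ℓ₀ = 3`
(`P3-C025-seven-three-plan.md` §9 (R3)(a)).
-/

namespace PercRepro

namespace SevenThree

open Finset ThmH SixThree CycCount LineCount StarApply

variable {α : Type*} [DecidableEq α] {M : Matroid α} [M.Finite]

/-- The sizes of a pairwise disjoint list sum to the size of the union. -/
theorem sum_map_card_eq_card_unionL (L : List (Finset α)) (hL : L.Pairwise Disjoint) :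
    (L.map Finset.card).sum = (unionL L).card := by
  induction L with
  | nil => rfl
  | cons N L ih =>
    rw [List.map_cons, List.sum_cons, unionL_cons, Finset.card_union_of_disjoint (disjoint_unionL_of_pairwise_cons hL),
      ih hL.of_cons]

/-- The table's bound for a descending list of length `5`. -/
theorem deltaN_ge_of_list {k l0 : ℕ} (hk : k < 3) (hl0 : l0 < 4) (l : List ℕ) (hlen : l.length = 5)
    (hd : l.Pairwise (fun a b => b ≤ a)) (hs : l.sum + l0 ≤ 5) : LineTable.lineBound l0 ≤ LineTable.deltaN k l0 l := by
  match l, hlen with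
  | [c1, c2, c3, c4, c5], _ =>
    have h21 : c2 ≤ c1 := List.rel_of_pairwise_cons hd (by simp)
    have h32 : c3 ≤ c2 := List.rel_of_pairwise_cons hd.of_cons (by simp)
    have h43 : c4 ≤ c3 := List.rel_of_pairwise_cons hd.of_cons.of_cons (by simp)
    have h54 : c5 ≤ c4 := List.rel_of_pairwise_cons hd.of_cons.of_cons.of_cons (by simp)
    simp only [List.sum_cons, List.sum_nil, add_zero] at hs
    exact LineTable.deltaN_ge_of_datum hk hl0 h21 h32 h43 h54 (by omega)

/-- `L₀ ⊆ λ` for a line `λ` (coloops lie in every closure). -/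
theorem coloops_subset_line {T W lam : Finset α} (h : ReducedWorld M T W) (hlamcl : dcl M T W lam = lam) :
    coloopsOf M (T ∪ W) ⊆ lam := by
  rw [← hlamcl]
  exact coloops_subset_dcl h

/-- `|λ| = |λ ∩ T| + |(λ ∩ W) ∖ L₀| + ℓ₀` for a line `λ`. -/
theorem card_line_split {T W lam : Finset α} (h : ReducedWorld M T W) (hr : M.eRank = 7) (hlamE : lam ⊆ T ∪ W)
    (hlamcl : dcl M T W lam = lam) :
    lam.card = (lam ∩ T).card + ((lam ∩ W) \ coloopsOf M (T ∪ W)).card + (coloopsOf M (T ∪ W)).card := by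
  have hL0 := coloops_subset_line h hlamcl
  have hLW := coloopsOf_world_subset h hr
  have h1 : lam = (lam ∩ T) ∪ (((lam ∩ W) \ coloopsOf M (T ∪ W)) ∪ coloopsOf M (T ∪ W)) := by
    ext e
    simp only [Finset.mem_union, Finset.mem_inter, Finset.mem_sdiff]
    constructor
    · intro he
      rcases Finset.mem_union.1 (hlamE he) with hh | hh
      · exact Or.inl ⟨he, hh⟩
      · by_cases hL : e ∈ coloopsOf M (T ∪ W)
        · exact Or.inr (Or.inr hL)
        · exact Or.inr (Or.inl ⟨⟨he, hh⟩, hL⟩)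
    · rintro (⟨he, -⟩ | ⟨⟨he, -⟩, -⟩ | he)
      · exact he
      · exact he
      · exact hL0 he
  have hd1 : Disjoint (lam ∩ T) (((lam ∩ W) \ coloopsOf M (T ∪ W)) ∪ coloopsOf M (T ∪ W)) := by
    rw [Finset.disjoint_left]
    intro e he he'
    rw [Finset.mem_inter] at he
    rcases Finset.mem_union.1 he' with hh | hh
    · exact Finset.disjoint_left.1 h.disj he.2 (Finset.mem_inter.1 (Finset.mem_sdiff.1 hh).1).2
    · exact Finset.disjoint_left.1 h.disj he.2 (hLW hh)
  have hd2 : Disjoint ((lam ∩ W) \ coloopsOf M (T ∪ W)) (coloopsOf M (T ∪ W)) := Finset.sdiff_disjoint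
  conv_lhs => rw [h1]
  rw [Finset.card_union_of_disjoint hd1, Finset.card_union_of_disjoint hd2]
  omega

/-- The datum of a nonempty line fibre: the circuit `E ∖ λ` has `≥ 3` points, `≥ 2` in `W`, `≥ 1` in `T`, so
`|λ ∩ T| ≤ 2` and `|λ ∩ W| ≤ 5`. -/
theorem line_datum_bounds {T W lam Z : Finset α} (h : ReducedWorld M T W) (hr : M.eRank = 7)
    (hlamE : lam ⊆ T ∪ W) (hlam2 : drk M (T ∪ W) lam = 2) (hlamcl : dcl M T W lam = lam)
    (hZ : Z ⊆ lam ∩ W) (hZ2 : drk M (T ∪ W) Z = 2) :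
    (lam ∩ T).card ≤ 2 ∧ (lam ∩ W).card ≤ 5 ∧ lam.card ≤ 7 := by
  obtain ⟨hnul, hcard10, hcyc, hcol⟩ := line_witness_data h hr hlamE hlam2 hlamcl hZ hZ2
  have hZW : Z ⊆ W := hZ.trans Finset.inter_subset_right
  have hSg : T ∪ (W \ Z) ⊆ gr M := Finset.union_subset h.T_sub (Finset.sdiff_subset.trans h.W_sub)
  have hCcard := card_cyclicPart_add (M := M) (T ∪ (W \ Z))
  have hCrk := eRk_cyclicPart_add hSg
  rw [← coe_nrk, ← coe_nrk] at hCrk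
  have hCrk' : nrk M (cyclicPart M (T ∪ (W \ Z))) + (coloopsOf M (T ∪ (W \ Z))).card = nrk M (T ∪ (W \ Z)) := by
    exact_mod_cast hCrk
  have hdep : nrk M (cyclicPart M (T ∪ (W \ Z))) < (cyclicPart M (T ∪ (W \ Z))).card := by omega
  rw [hcyc] at hdep
  have hCE : (T ∪ W) \ lam ⊆ T ∪ W := Finset.sdiff_subset
  have h3 := three_le_card_of_dep h hCE hdep
  have h2 := two_le_card_inter_W_of_dep h hCE hdep
  have h1 := one_le_card_inter_T_of_dep h hCE hdep
  have hCT : (((T ∪ W) \ lam) ∩ T).card + (lam ∩ T).card = 3 := by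
    have : ((T ∪ W) \ lam) ∩ T = T \ (lam ∩ T) := by
      ext e
      simp only [Finset.mem_inter, Finset.mem_sdiff, Finset.mem_union, not_and]
      constructor
      · rintro ⟨⟨-, hl⟩, hT⟩
        exact ⟨hT, fun hh => absurd hh hl⟩
      · rintro ⟨hT, hh⟩
        exact ⟨⟨Or.inl hT, fun hl => hh hl hT⟩, hT⟩
    rw [this, Finset.card_sdiff_of_subset Finset.inter_subset_right, h.T_card]
    have := Finset.card_le_card (Finset.inter_subset_right : lam ∩ T ⊆ T)
    rw [h.T_card] at this
    omega
  have hCW : (((T ∪ W) \ lam) ∩ W).card + (lam ∩ W).card = 7 := by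
    have : ((T ∪ W) \ lam) ∩ W = W \ (lam ∩ W) := by
      ext e
      simp only [Finset.mem_inter, Finset.mem_sdiff, Finset.mem_union, not_and]
      constructor
      · rintro ⟨⟨-, hl⟩, hW⟩
        exact ⟨hW, fun hh => absurd hh hl⟩
      · rintro ⟨hW, hh⟩
        exact ⟨⟨Or.inr hW, fun hl => hh hl hW⟩, hW⟩
    rw [this, Finset.card_sdiff_of_subset Finset.inter_subset_right, h.W_card]
    have := Finset.card_le_card (Finset.inter_subset_right : lam ∩ W ⊆ W)
    rw [h.W_card] at this
    omega
  have hlam10 : ((T ∪ W) \ lam).card + lam.card = 10 := by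
    rw [Finset.card_sdiff_of_subset hlamE, card_world h]
    have := Finset.card_le_card hlamE
    rw [card_world h] at this
    omega
  exact ⟨by omega, by omega, by omega⟩

open scoped Classical in
/-- **THE LINE FIBRE SUM**: for a line `λ` of the dual, the brackets of the witnesses with `Z ⊆ λ ∩ W`, `drk Z = 2`
sum to `deltaN |λ ∩ T| ℓ₀ cs / Lc`, `cs` the class sizes of `(λ ∩ W) ∖ L₀`. -/
theorem line_fibre_sum {T W lam : Finset α} (h : ReducedWorld M T W) (hr : M.eRank = 7) (hlamE : lam ⊆ T ∪ W)
    (hlam2 : drk M (T ∪ W) lam = 2) (hlamcl : dcl M T W lam = lam) :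
    ∑ Z ∈ (lam ∩ W).powerset.filter (fun Z => drk M (T ∪ W) Z = 2), bracket M T (W \ Z) =
      ((LineTable.deltaN (lam ∩ T).card (coloopsOf M (T ∪ W)).card
        ((lineClassList M T W ((lam ∩ W) \ coloopsOf M (T ∪ W))).map Finset.card) : ℤ) : ℚ) / (LineTable.Lc : ℚ) := by
  have hE := world_subset h
  have hLW := coloopsOf_world_subset h hr
  have hL0 := coloops_subset_line h hlamcl
  have hsplit := card_line_split h hr hlamE hlamcl
  set A := (lam ∩ W) \ coloopsOf M (T ∪ W) with hAdef
  have hAcyc : A ⊆ cyclicPart M (T ∪ W) := by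
    intro e he
    rw [hAdef, Finset.mem_sdiff, Finset.mem_inter] at he
    exact Finset.mem_sdiff.2 ⟨Finset.mem_union_right T he.1.2, he.2⟩
  have hdisj : Disjoint A (coloopsOf M (T ∪ W)) := Finset.sdiff_disjoint
  have hlamW : lam ∩ W = A ∪ coloopsOf M (T ∪ W) := by
    rw [hAdef, Finset.sdiff_union_of_subset (Finset.subset_inter hL0 hLW)]
  have hpair := lineClassList_pairwise (A := A) h
  have hLc : (0 : ℚ) < (LineTable.Lc : ℚ) := by exact_mod_cast Lc_pos
  -- the pointwise transfer, for `Z ⊆ λ ∩ W`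
  have hpt : ∀ Z ∈ (lam ∩ W).powerset, (if drk M (T ∪ W) Z = 2 then bracket M T (W \ Z) else 0) =
      ((LineTable.bracketN (lam ∩ T).card (coloopsOf M (T ∪ W)).card A.card (Z \ coloopsOf M (T ∪ W)).card
        (Z ∩ coloopsOf M (T ∪ W)).card (hitsL (lineClassList M T W A) (Z \ coloopsOf M (T ∪ W))) : ℤ) : ℚ) /
        (LineTable.Lc : ℚ) := by
    intro Z hZ
    rw [Finset.mem_powerset] at hZ
    have hZW : Z ⊆ W := hZ.trans Finset.inter_subset_right
    have hZ1 : Z \ coloopsOf M (T ∪ W) ⊆ A := by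
      intro e he
      rw [Finset.mem_sdiff] at he
      exact Finset.mem_sdiff.2 ⟨hZ he.1, he.2⟩
    have hZsplit : Z.card = (Z \ coloopsOf M (T ∪ W)).card + (Z ∩ coloopsOf M (T ∪ W)).card := by
      rw [← Finset.card_union_of_disjoint (Finset.disjoint_sdiff_inter Z _), Finset.sdiff_union_inter]
    have hzP : (Z \ coloopsOf M (T ∪ W)).card ≤ A.card := Finset.card_le_card hZ1
    have hzl : (Z ∩ coloopsOf M (T ∪ W)).card ≤ (coloopsOf M (T ∪ W)).card := Finset.card_le_card Finset.inter_subset_right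
    have hdZ : drk M (T ∪ W) Z = drk M (T ∪ W) (Z \ coloopsOf M (T ∪ W)) := drk_eq_drk_sdiff_coloops h
    have hhits := two_le_hitsL_iff h hAcyc hZ1
    have hdle : drk M (T ∪ W) Z ≤ 2 := by rw [← hlam2]; exact drk_mono (hZ.trans Finset.inter_subset_left)
    unfold LineTable.bracketN
    by_cases hd2 : drk M (T ∪ W) Z = 2
    · rw [if_pos hd2]
      have hh2 : 2 ≤ hitsL (lineClassList M T W A) (Z \ coloopsOf M (T ∪ W)) := hhits.2 (by omega)
      obtain ⟨hlamT, hlamW5, hlam7⟩ := line_datum_bounds h hr hlamE hlam2 hlamcl hZ hd2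
      by_cases hZ3 : 3 ≤ Z.card
      · rw [if_neg (by omega), bracket_line_eq h hr hlamE hlam2 hlamcl hZ hd2 hZ3]
        have ha : (lam ∩ T).card + (A.card - (Z \ coloopsOf M (T ∪ W)).card) +
            ((coloopsOf M (T ∪ W)).card - (Z ∩ coloopsOf M (T ∪ W)).card) = lam.card - Z.card := by omega
        have hx : 7 - ((Z \ coloopsOf M (T ∪ W)).card + (Z ∩ coloopsOf M (T ∪ W)).card) = 7 - Z.card := by omega
        rw [ha, hx]
        have hZ5 : Z.card ≤ 5 := (Finset.card_le_card hZ).trans hlamW5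
        obtain ⟨hdvd, hpos⟩ := DlineN_box (a := lam.card - Z.card) (x := 7 - Z.card) (by omega) (by omega) (by omega)
        push_cast
        rw [Int.cast_div hdvd (by exact_mod_cast hpos.ne'), LineCount.phiTermN_cast]
        have hD : ((LineTable.DlineN (lam.card - Z.card) (7 - Z.card) : ℤ) : ℚ) ≠ 0 := by exact_mod_cast hpos.ne'
        by_cases h3 : 7 - Z.card ≤ 3
        · rw [if_pos h3, if_pos h3]
          have hc : ((Nat.choose (7 - Z.card + 3) 3 : ℕ) : ℚ) ≠ 0 := by
            have := Nat.choose_pos (show 3 ≤ 7 - Z.card + 3 by omega)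
            exact_mod_cast this.ne'
          field_simp
        · rw [if_neg h3, if_neg h3]
          field_simp
          ring
      · -- `|Z| ≤ 2`: not a witness, no generic term
        rw [if_pos (Or.inr (by omega)), Int.cast_zero, zero_div]
        obtain ⟨hnul, -, -, -⟩ := line_witness_data h hr hlamE hlam2 hlamcl hZ hd2
        have hnul' : M.eRk ((T ∪ (W \ Z) : Finset α) : Set α) + 1 = ((T ∪ (W \ Z)).card : ℕ∞) := by
          rw [← coe_nrk, ← hnul]
          push_cast
          rfl
        apply bracket_of_nullity_one_of_five_le h Finset.sdiff_subset hnul'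
        rw [Finset.card_sdiff_of_subset hZW, h.W_card]
        omega
    · rw [if_neg hd2]
      have hh : hitsL (lineClassList M T W A) (Z \ coloopsOf M (T ∪ W)) < 2 := by
        by_contra hcon
        have := hhits.1 (by omega)
        omega
      rw [if_pos (Or.inl hh), Int.cast_zero, zero_div]
  rw [Finset.sum_filter, Finset.sum_congr rfl hpt, hlamW, sum_powerset_union hdisj]
  -- the table side
  unfold LineTable.deltaN
  rw [classSum_eq_sum _ _ _ _ hpair, unionL_lineClassList hAcyc, sum_map_card_eq_card_unionL _ hpair,
    unionL_lineClassList hAcyc, one_mul]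
  push_cast
  rw [Finset.sum_div]
  apply Finset.sum_congr rfl
  intro Z₁ hZ₁
  rw [Finset.mem_powerset] at hZ₁
  have hZ₁cyc : Disjoint Z₁ (coloopsOf M (T ∪ W)) := hdisj.mono_left hZ₁
  -- the inner sums over `Z_ℓ ⊆ L₀` by size
  have hinner : ∀ Zl ∈ (coloopsOf M (T ∪ W)).powerset,
      ((LineTable.bracketN (lam ∩ T).card (coloopsOf M (T ∪ W)).card A.card ((Z₁ ∪ Zl) \ coloopsOf M (T ∪ W)).card
        ((Z₁ ∪ Zl) ∩ coloopsOf M (T ∪ W)).card (hitsL (lineClassList M T W A) ((Z₁ ∪ Zl) \ coloopsOf M (T ∪ W))) : ℤ) : ℚ) /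
        (LineTable.Lc : ℚ) =
      ((LineTable.bracketN (lam ∩ T).card (coloopsOf M (T ∪ W)).card A.card Z₁.card Zl.card
        (hitsL (lineClassList M T W A) Z₁) : ℤ) : ℚ) / (LineTable.Lc : ℚ) := by
    intro Zl hZl
    rw [Finset.mem_powerset] at hZl
    have h1 : (Z₁ ∪ Zl) \ coloopsOf M (T ∪ W) = Z₁ := by
      rw [Finset.union_sdiff_distrib, Finset.sdiff_eq_self_of_disjoint hZ₁cyc,
        Finset.sdiff_eq_empty_iff_subset.2 hZl, Finset.union_empty]
    have h2 : (Z₁ ∪ Zl) ∩ coloopsOf M (T ∪ W) = Zl := by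
      rw [Finset.union_inter_distrib_right, Finset.disjoint_iff_inter_eq_empty.1 hZ₁cyc, Finset.empty_union]
      exact Finset.inter_eq_left.2 hZl
    rw [h1, h2]
  rw [Finset.sum_congr rfl hinner]
  rw [Finset.sum_powerset_apply_card (fun b => ((LineTable.bracketN (lam ∩ T).card (coloopsOf M (T ∪ W)).card A.card
    Z₁.card b (hitsL (lineClassList M T W A) Z₁) : ℤ) : ℚ) / (LineTable.Lc : ℚ))]
  rw [Finset.sum_div]
  apply Finset.sum_congr rfl
  intro zl _
  rw [nsmul_eq_mul, zero_add, zero_add]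
  ring

/-- A list of positive naturals has length at most its sum. -/
theorem length_le_sum_of_pos (l : List ℕ) (hl : ∀ x ∈ l, 1 ≤ x) : l.length ≤ l.sum := by
  induction l with
  | nil => simp
  | cons x l ih =>
    rw [List.length_cons, List.sum_cons]
    have := hl x (List.mem_cons_self ..)
    have := ih (fun y hy => hl y (List.mem_cons_of_mem x hy))
    omega

/-- `lineClassList` is sorted by decreasing size. -/
theorem lineClassList_sorted (T W A : Finset α) :
    (lineClassList M T W A).Pairwise (fun a b => b.card ≤ a.card) := by
  have := List.pairwise_mergeSort (le := fun a b : Finset α => decide (b.card ≤ a.card))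
    (by
      intro a b c hab hbc
      simp only [decide_eq_true_iff] at hab hbc ⊢
      omega)
    (by
      intro a b
      by_cases hab : b.card ≤ a.card
      · simp [hab]
      · simp only [Bool.or_eq_true, decide_eq_true_iff]
        omega)
    (lineTraces M T W A).toList
  exact this.imp (fun hh => decide_eq_true_iff.1 hh)

/-- `lineBound ℓ₀ ≤ 0`. -/
theorem lineBound_nonpos (l0 : ℕ) : LineTable.lineBound l0 ≤ 0 := by
  unfold LineTable.lineBound
  split_ifs <;> omega

open scoped Classical in
/-- **THE LINE FIBRE BOUND**: `Σ_{fibre of λ} bracket ≥ lineBound ℓ₀ / Lc`. -/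
theorem line_fibre_bound {T W lam : Finset α} (h : ReducedWorld M T W) (hr : M.eRank = 7) (hlamE : lam ⊆ T ∪ W)
    (hlam2 : drk M (T ∪ W) lam = 2) (hlamcl : dcl M T W lam = lam) :
    ((LineTable.lineBound (coloopsOf M (T ∪ W)).card : ℤ) : ℚ) / (LineTable.Lc : ℚ) ≤
      ∑ Z ∈ (lam ∩ W).powerset.filter (fun Z => drk M (T ∪ W) Z = 2), bracket M T (W \ Z) := by
  have hLc : (0 : ℚ) < (LineTable.Lc : ℚ) := by exact_mod_cast Lc_pos
  by_cases hfib : ∃ Z ∈ (lam ∩ W).powerset, drk M (T ∪ W) Z = 2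
  · obtain ⟨Z₀, hZ₀, hd⟩ := hfib
    rw [Finset.mem_powerset] at hZ₀
    obtain ⟨hlamT, hlamW5, -⟩ := line_datum_bounds h hr hlamE hlam2 hlamcl hZ₀ hd
    have hl0 := card_coloopsOf_world_le h hr
    have hL0 := coloops_subset_line h hlamcl
    have hLW := coloopsOf_world_subset h hr
    rw [line_fibre_sum h hr hlamE hlam2 hlamcl, div_le_div_iff_of_pos_right hLc]
    set A := (lam ∩ W) \ coloopsOf M (T ∪ W) with hAdef
    have hAcyc : A ⊆ cyclicPart M (T ∪ W) := by
      intro e he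
      rw [hAdef, Finset.mem_sdiff, Finset.mem_inter] at he
      exact Finset.mem_sdiff.2 ⟨Finset.mem_union_right T he.1.2, he.2⟩
    have hpair := lineClassList_pairwise (A := A) h
    have hA5 : A.card + (coloopsOf M (T ∪ W)).card ≤ 5 := by
      rw [hAdef, Finset.card_sdiff_of_subset (Finset.subset_inter hL0 hLW)]
      have := Finset.card_le_card (Finset.subset_inter hL0 hLW : coloopsOf M (T ∪ W) ⊆ lam ∩ W)
      omega
    set cs := (lineClassList M T W A).map Finset.card with hcsdef
    have hsum : cs.sum = A.card := by
      rw [hcsdef, sum_map_card_eq_card_unionL _ hpair, unionL_lineClassList hAcyc]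
    have hpos : ∀ x ∈ cs, 1 ≤ x := by
      intro x hx
      rw [hcsdef, List.mem_map] at hx
      obtain ⟨tr, htr, rfl⟩ := hx
      obtain ⟨N, -, hne, rfl⟩ := mem_lineTraces.1 (mem_lineClassList.1 htr)
      exact Finset.card_pos.2 hne
    have hlen : cs.length ≤ 5 := (length_le_sum_of_pos cs hpos).trans (by omega)
    have hsorted : cs.Pairwise (fun a b => b ≤ a) := by
      rw [hcsdef, List.pairwise_map]
      exact lineClassList_sorted T W A
    -- pad to length `5`
    have h5 := deltaN_ge_of_list (k := (lam ∩ T).card) (l0 := (coloopsOf M (T ∪ W)).card) (by omega) (by omega)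
      (cs ++ List.replicate (5 - cs.length) 0)
      (by rw [List.length_append, List.length_replicate]; omega)
      (by
        rw [List.pairwise_append]
        refine ⟨hsorted, List.pairwise_replicate.2 (Or.inr (le_refl 0)), ?_⟩
        intro a _ b hb
        rw [List.mem_replicate] at hb
        omega)
      (by rw [List.sum_append, List.sum_replicate, smul_zero, add_zero, hsum]; omega)
    rw [deltaN_append_zeros] at h5
    exact_mod_cast h5
  · have hempty : (lam ∩ W).powerset.filter (fun Z => drk M (T ∪ W) Z = 2) = ∅ := by
      apply Finset.filter_eq_empty_iff.2
      intro Z hZ hd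
      exact hfib ⟨Z, hZ, hd⟩
    rw [hempty, Finset.sum_empty]
    apply div_nonpos_of_nonpos_of_nonneg _ hLc.le
    exact_mod_cast lineBound_nonpos _

end SevenThree

end PercRepro
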